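import Literature.Geometry.Lorentzian.StronglyAsymptoticallyFlatADMEnergy
import Literature.Geometry.Lorentzian.InitialDataPullback
import HarnessLib

/-!
# The ADM linear momentum of a strongly asymptotically flat end vanishes

If the data are strongly asymptotically flat on the end `e` in the sense of Dafermos–Rodnianski,
`h_ij = (1 + 2M/r) δ_ij + o₂(r⁻¹)`, `k_ij = o₁(r⁻²)` (`AFEnd.IsStronglyAsymptoticallyFlatDR e D M`),
then the ADM momentum fluxes `Pᵢ(r) = (8π)⁻¹ ∮_{S_r} ∑ⱼ (k_ij − (tr_h k) h_ij) xʲ/r dσ` tend to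
`0`: `AFEnd.HasADMMomentum e D i 0` for `i = 1, 2, 3`
(`AFEnd.IsStronglyAsymptoticallyFlatDR.hasADMMomentum_zero`), so `admMomentum e D i = 0` and
the ADM mass `√(E² − |P|²)` of such an end is `|M|`.

Proof: `k = o(r⁻²)` and `h → δ` uniformly on `S_r`; the metric trace satisfies
`|tr_h k| ≤ 3 · sup |k| / λ_min(h) ≤ 6 ‖k‖` once `‖h − δ‖ ≤ 1/2` (index raising by a metric
`≥ ½ δ` at most doubles norms; `tr_h k` read in the chart of the end is the `h`-trace of `k` of
the pulled-back data, `InitialDataSet.traceK_comap`), so the integrand is `o(r⁻²)` and its flux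
through `S_r` (area `4πr²`) is `o(1)`.

## References

* R. Arnowitt, S. Deser, C. W. Misner, *The dynamics of general relativity* (1962), the ADM
  four-momentum.
* M. Dafermos, I. Rodnianski, *Lectures on black holes and linear waves*, Clay Math. Proc. 17
  (2013), App. B.2.3 (the class `o₂(r⁻¹)`, `o₁(r⁻²)`; `E = M`, `P = 0` for its members).
* R. Bartnik, J. Isenberg, *The constraint equations* (2004), §2 (ADM momentum).
* D. A. Lee, *Geometric Relativity*, AMS GSM 201 (2019), §7.3 (ADM energy–momentum).
-/

noncomputable section

-- instance search on the nested operator spaces of metric components (`E3 →L[ℝ] E3 →L[ℝ] ℝ`)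
-- is deep and slow on `E3` (as in `StronglyAsymptoticallyFlatADMEnergy`)
set_option maxSynthPendingDepth 3
set_option synthInstance.maxHeartbeats 200000

open Set Filter Asymptotics Bornology Metric MeasureTheory Topology InnerProductSpace
open scoped Real ContDiff RealInnerProductSpace Manifold ENNReal

namespace Literature.Geometry.Lorentzian

open Literature.MeasureTheory.Hausdorff

/-! ### Linear algebra: the trace of a form raised by a coercive metric -/

/-- **Trace bound for index raising by a coercive form.** On `E3`, let `H` be a continuous
bilinear form with `c ‖v‖² ≤ H(v, v)` (`c > 0`) and let `A : E3 →ₗ E3` and a bilinear form `T` be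
related by `H(A v, w) = T(v, w)` (so `A = H⁻¹ T`, "`T` with an index raised"), with
`|T(v, w)| ≤ K ‖v‖ ‖w‖`. Then `‖A v‖ ≤ (K/c) ‖v‖` and `|tr A| ≤ 3K/c` (the trace is the sum of the
three diagonal entries in the standard basis). [folklore] -/
theorem abs_trace_le_of_coercive (H : E3 →L[ℝ] E3 →L[ℝ] ℝ) (T : LinearMap.BilinForm ℝ E3)
    (A : E3 →ₗ[ℝ] E3) {c K : ℝ} (hc : 0 < c) (hK : 0 ≤ K)
    (hH : ∀ v : E3, c * ‖v‖ ^ 2 ≤ H v v) (hA : ∀ v w : E3, H (A v) w = T v w)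
    (hT : ∀ v w : E3, |T v w| ≤ K * ‖v‖ * ‖w‖) :
    |LinearMap.trace ℝ E3 A| ≤ 3 * K / c := by
  -- `‖A v‖ ≤ (K/c) ‖v‖`
  have hAv : ∀ v : E3, ‖A v‖ ≤ K / c * ‖v‖ := by
    intro v
    have h1 : c * ‖A v‖ ^ 2 ≤ K * ‖v‖ * ‖A v‖ := by
      calc c * ‖A v‖ ^ 2 ≤ H (A v) (A v) := hH (A v)
        _ = T v (A v) := hA v (A v)
        _ ≤ |T v (A v)| := le_abs_self _
        _ ≤ K * ‖v‖ * ‖A v‖ := hT v (A v)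
    by_cases h0 : ‖A v‖ = 0
    · rw [h0]; positivity
    · have hpos : 0 < ‖A v‖ := lt_of_le_of_ne (norm_nonneg _) (Ne.symm h0)
      rw [div_mul_eq_mul_div, le_div_iff₀ hc]
      have h2 : c * ‖A v‖ * ‖A v‖ ≤ K * ‖v‖ * ‖A v‖ := by rw [mul_assoc, ← sq]; exact h1
      have h3 := le_of_mul_le_mul_right h2 hpos
      linarith
  -- the trace as the sum of the diagonal entries in the standard basis
  have htr : LinearMap.trace ℝ E3 A =
      ∑ i : Fin 3, (A (EuclideanSpace.single i 1)) i := by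
    rw [LinearMap.trace_eq_matrix_trace ℝ (EuclideanSpace.basisFun (Fin 3) ℝ).toBasis A,
      Matrix.trace]
    refine Finset.sum_congr rfl fun i _ ↦ ?_
    rw [Matrix.diag_apply, LinearMap.toMatrix_apply]
    simp
  rw [htr]
  calc |∑ i : Fin 3, (A (EuclideanSpace.single i 1)) i|
      ≤ ∑ i : Fin 3, |(A (EuclideanSpace.single i 1)) i| := Finset.abs_sum_le_sum_abs _ _
    _ ≤ ∑ _i : Fin 3, K / c := Finset.sum_le_sum fun i _ ↦ by
        have h1 : |(A (EuclideanSpace.single i 1)) i| ≤ ‖A (EuclideanSpace.single i 1)‖ := by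
          rw [← Real.norm_eq_abs]
          exact PiLp.norm_apply_le _ i
        have h2 := hAv (EuclideanSpace.single i 1)
        rw [PiLp.norm_single, norm_one, mul_one] at h2
        exact h1.trans h2
    _ = 3 * K / c := by simp; ring

/-! ### The mean curvature read in the chart is controlled by `k` -/

namespace AFEnd

variable {X : Type*} [TopologicalSpace X] [ChartedSpace E3 X] [IsManifold (𝓡 3) ∞ X]
  (e : AFEnd X) (D : InitialDataSet (𝓡 3) X)

/-- **`|tr_h k| ≤ 6 sup|k|` where `h ≥ ½ δ`.** For `R < ‖x‖`, if the chart components satisfy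
`½ ‖v‖² ≤ h_x(v, v)` and `|k_x(v, w)| ≤ K ‖v‖ ‖w‖`, then `|tr_h k (Φ x)| ≤ 6K`: the mean curvature
read in the chart of the end is the `Φ^*h`-trace of `Φ^*k` for the pulled-back data on the
exterior region (`InitialDataSet.traceK_comap`), i.e. the trace of `k_x` with an index raised by
`h_x` (`abs_trace_le_of_coercive`). Bartnik–Isenberg 2004, §2. [cite: BartnikIsenberg2004, §2] -/
theorem abs_trKCoeff_le {x : E3} (hx : e.R < ‖x‖) {K : ℝ} (hK : 0 ≤ K)
    (hH : ∀ v : E3, 1 / 2 * ‖v‖ ^ 2 ≤ hCoeff e D x v v)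
    (hT : ∀ v w : E3, |kCoeff e D x v w| ≤ K * ‖v‖ * ‖w‖) :
    |trKCoeff e D x| ≤ 6 * K := by
  set Dc : InitialDataSet (𝓡 3) (exteriorRegion e.R) :=
    D.comap e.dataChart e.contMDiff_dataChart_succ e.injective_mfderiv_dataChart with hDc
  have h1 : trKCoeff e D x = Dc.traceK ⟨x, hx⟩ := by
    rw [hDc, InitialDataSet.traceK_comap D e.contMDiff_dataChart_succ
      e.injective_mfderiv_dataChart rfl]
    unfold trKCoeff
    rw [dif_pos hx]
  -- the metric and `k` of the pulled-back data at `x` are the chart components (the two sides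
  -- live on `T_x {R < ‖y‖} = E3`, definitionally; all identifications below are by `exact`)
  have hval : ∀ v w : E3, Dc.metric.val ⟨x, hx⟩ v w = hCoeff e D x v w := by
    intro v w
    rw [hDc, InitialDataSet.comap_metric D e.contMDiff_dataChart_succ
      e.injective_mfderiv_dataChart rfl, e.val_comap_dataChart D ⟨x, hx⟩]
    rfl
  have hk : ∀ v w : E3, Dc.kBilin ⟨x, hx⟩ v w = kCoeff e D x v w := by
    intro v w
    rw [kCoeff_of_lt D hx]
    rfl
  rw [h1]
  have key := abs_trace_le_of_coercive (hCoeff e D x) (Dc.kBilin ⟨x, hx⟩)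
    ((Dc.metric.sharp ⟨x, hx⟩).toLinearMap ∘ₗ Dc.kBilin ⟨x, hx⟩) (c := 1 / 2) (by norm_num) hK hH
    (fun v w ↦ (hval _ w).symm.trans (Dc.metric.val_sharp_apply ⟨x, hx⟩ _ w))
    (fun v w ↦ (congrArg abs (hk v w)).trans_le (hT v w))
  calc |Dc.traceK ⟨x, hx⟩|
      = |LinearMap.trace ℝ E3 ((Dc.metric.sharp ⟨x, hx⟩).toLinearMap ∘ₗ Dc.kBilin ⟨x, hx⟩)| :=
        rfl
    _ ≤ 3 * K / (1 / 2) := key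
    _ = 6 * K := by ring

/-! ### The theorem -/

/-- The momentum flux integrand `x ↦ ∑ⱼ (k_ij − (tr_h k) h_ij)(x) xʲ/r`, pointwise: if
`|k_x(v, w)| ≤ κ ‖v‖ ‖w‖`, `|tr_h k (Φ x)| ≤ 6κ` and `‖h_x‖ ≤ 3/2`, then on the sphere `‖x‖ = r`
it is bounded by `30 κ` (three terms, each `≤ κ + 6κ · 3/2`). [folklore] -/
theorem abs_admMomentumIntegrand_le (i : Fin 3) {x : E3} {r κ : ℝ} (hr : 0 < r) (hxr : ‖x‖ = r)
    (hκ : 0 ≤ κ) (hk : ∀ v w : E3, |kCoeff e D x v w| ≤ κ * ‖v‖ * ‖w‖)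
    (htr : |trKCoeff e D x| ≤ 6 * κ) (hh : ‖hCoeff e D x‖ ≤ 3 / 2) :
    |∑ j : Fin 3, (kCoeff e D x (EuclideanSpace.single i 1) (EuclideanSpace.single j 1)
        - trKCoeff e D x *
          hCoeff e D x (EuclideanSpace.single i 1) (EuclideanSpace.single j 1)) * x j / r| ≤
      30 * κ := by
  have hterm : ∀ j : Fin 3,
      |(kCoeff e D x (EuclideanSpace.single i 1) (EuclideanSpace.single j 1)
        - trKCoeff e D x *
          hCoeff e D x (EuclideanSpace.single i 1) (EuclideanSpace.single j 1)) * x j / r| ≤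
        10 * κ := by
    intro j
    have h1 : |kCoeff e D x (EuclideanSpace.single i 1) (EuclideanSpace.single j 1)| ≤ κ := by
      have := hk (EuclideanSpace.single i 1) (EuclideanSpace.single j 1)
      simpa [PiLp.norm_single] using this
    have h2 : |hCoeff e D x (EuclideanSpace.single i 1) (EuclideanSpace.single j 1)| ≤ 3 / 2 := by
      have := (hCoeff e D x).le_opNorm₂ (EuclideanSpace.single i (1 : ℝ))
        (EuclideanSpace.single j (1 : ℝ))
      rw [PiLp.norm_single, PiLp.norm_single, norm_one, mul_one, mul_one, Real.norm_eq_abs] at this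
      exact this.trans hh
    have h3 : |x j| ≤ r := by
      rw [← hxr, ← Real.norm_eq_abs]
      exact PiLp.norm_apply_le x j
    have h4 : |kCoeff e D x (EuclideanSpace.single i 1) (EuclideanSpace.single j 1)
        - trKCoeff e D x *
          hCoeff e D x (EuclideanSpace.single i 1) (EuclideanSpace.single j 1)| ≤ 10 * κ := by
      calc _ ≤ |kCoeff e D x (EuclideanSpace.single i 1) (EuclideanSpace.single j 1)| +
            |trKCoeff e D x *
              hCoeff e D x (EuclideanSpace.single i 1) (EuclideanSpace.single j 1)| :=
            abs_sub _ _
        _ ≤ κ + 6 * κ * (3 / 2) := by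
            rw [abs_mul]
            exact add_le_add h1 (mul_le_mul htr h2 (abs_nonneg _) (by positivity))
        _ = 10 * κ := by ring
    rw [abs_div, abs_mul, abs_of_pos hr, div_le_iff₀ hr]
    calc _ ≤ 10 * κ * r := mul_le_mul h4 h3 (abs_nonneg _) (by positivity)
      _ = 10 * κ * r := rfl
  calc _ ≤ ∑ j : Fin 3, |(kCoeff e D x (EuclideanSpace.single i 1) (EuclideanSpace.single j 1)
        - trKCoeff e D x *
          hCoeff e D x (EuclideanSpace.single i 1) (EuclideanSpace.single j 1)) * x j / r| :=
        Finset.abs_sum_le_sum_abs _ _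
    _ ≤ ∑ _j : Fin 3, 10 * κ := Finset.sum_le_sum fun j _ ↦ hterm j
    _ = 30 * κ := by simp; ring

/-- **The ADM linear momentum of a DR-strongly asymptotically flat end vanishes**: if
`h_ij = (1 + 2M/r) δ_ij + o₂(r⁻¹)` and `k_ij = o₁(r⁻²)` on the end `e`
(`IsStronglyAsymptoticallyFlatDR e D M`), then the ADM momentum fluxes `Pᵢ(r)` converge to `0`,
`HasADMMomentum e D i 0`. For `r` beyond a far radius, `|Pᵢ(r)| ≤ (8π)⁻¹ · 4πr² · 30 sup_{S_r} ‖k‖`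
with `sup_{S_r} ‖k‖ = o(r⁻²)` (`abs_admMomentumIntegrand_le`, `abs_trKCoeff_le`,
`μHE[2](S_r) = 4πr²`). Dafermos–Rodnianski 2013, App. B.2.3; Bartnik–Isenberg 2004, §2; Lee 2019,
§7.3. [cite: DafermosRodnianski2013, App. B.2.3] -/
theorem IsStronglyAsymptoticallyFlatDR.hasADMMomentum_zero {e : AFEnd X}
    {D : InitialDataSet (𝓡 3) X} {M : ℝ} (h : IsStronglyAsymptoticallyFlatDR e D M) (i : Fin 3) :
    HasADMMomentum e D i 0 := by
  -- `‖k(x)‖ = o(‖x‖⁻²)`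
  have hko : (fun x ↦ ‖kCoeff e D x‖) =o[cobounded E3] fun x ↦ (‖x‖ ^ 2)⁻¹ := by
    have h1 := h.2 0 (Nat.zero_le _)
    refine (h1.congr_left fun x ↦ ?_).congr_right ?_
    · rw [norm_iteratedFDeriv_zero]
    · intro x
      rw [show (-(2 : ℝ) - ((0 : ℕ) : ℝ)) = -(2 : ℝ) by norm_num, Real.rpow_neg (norm_nonneg x),
        Real.rpow_two]
  -- `‖h(x) − δ‖ = O(‖x‖⁻¹)`, hence eventually `≤ 1/2`
  set B : E3 →L[ℝ] E3 →L[ℝ] ℝ := (innerSL ℝ : E3 →L[ℝ] E3 →L[ℝ] ℝ) with hB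
  have hhO : (fun x ↦ ‖hCoeff e D x - B‖) =O[cobounded E3] fun x ↦ ‖x‖⁻¹ := by
    have h1 := ((IsStronglyAsymptoticallyFlatDR.IsAsymptoticallyFlat_one_holds e D) h).1 0
      (Nat.zero_le _)
    refine (h1.congr_left fun x ↦ ?_).congr_right ?_
    · rw [norm_iteratedFDeriv_zero]
    · intro x
      rw [show (-(1 : ℝ) - ((0 : ℕ) : ℝ)) = -(1 : ℝ) by norm_num, Real.rpow_neg_one]
  have hh_ev : ∀ᶠ x in cobounded E3, ‖hCoeff e D x - B‖ ≤ 1 / 2 := by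
    obtain ⟨C, hC0, hC⟩ := hhO.exists_pos
    rw [IsBigOWith] at hC
    filter_upwards [hC, eventually_cobounded_le_norm (E := E3) (2 * C)] with x h1 h2
    have hx0 : 0 < ‖x‖ := lt_of_lt_of_le (by positivity) h2
    rw [norm_norm, Real.norm_of_nonneg (inv_nonneg.2 (norm_nonneg x))] at h1
    calc ‖hCoeff e D x - B‖ ≤ C * ‖x‖⁻¹ := h1
      _ ≤ C * (2 * C)⁻¹ := by gcongr
      _ = 1 / 2 := by field_simp
  rw [HasADMMomentum, Metric.tendsto_atTop]
  intro ε hε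
  have hε16 : 0 < ε / 16 := by positivity
  obtain ⟨R₂, -, hR₂⟩ := hasBasis_cobounded_norm.eventually_iff.1 ((hko.def hε16).and hh_ev)
  set r₀ : ℝ := max (max e.R 1) R₂ + 1 with hr₀
  refine ⟨r₀, fun r hr ↦ ?_⟩
  have hrR : e.R < r := by
    have : e.R ≤ max (max e.R 1) R₂ := (le_max_left _ _).trans (le_max_left _ _)
    linarith
  have hrR₂ : R₂ ≤ r := by
    have : R₂ ≤ max (max e.R 1) R₂ := le_max_right _ _
    linarith
  have hr0 : 0 < r := lt_trans e.R_pos hrR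
  set μ : Measure E3 := μHE[2] with hμ
  set S : Set E3 := sphere 0 r with hS
  set I : E3 → ℝ := fun x ↦ ∑ j : Fin 3,
    (kCoeff e D x (EuclideanSpace.single i 1) (EuclideanSpace.single j 1)
      - trKCoeff e D x *
        hCoeff e D x (EuclideanSpace.single i 1) (EuclideanSpace.single j 1)) * x j / r with hI
  have hμS : μ S = ENNReal.ofReal (4 * Real.pi * r ^ 2) :=
    euclideanHausdorffMeasure_sphere_fin_three hr0
  have hμS' : μ S < ⊤ := by rw [hμS]; exact ENNReal.ofReal_lt_top
  have hμSr : μ.real S = 4 * Real.pi * r ^ 2 := by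
    rw [measureReal_def, hμS, ENNReal.toReal_ofReal (by positivity)]
  -- pointwise bound on the sphere
  have hbd : ∀ x ∈ S, ‖I x‖ ≤ 30 * (ε / 16 / r ^ 2) := by
    intro x hx
    have hxr : ‖x‖ = r := by rwa [hS, mem_sphere_zero_iff_norm] at hx
    have hxR : e.R < ‖x‖ := by rw [hxr]; exact hrR
    obtain ⟨hk1, hh1⟩ := hR₂ (show R₂ ≤ ‖x‖ by rw [hxr]; exact hrR₂)
    rw [Real.norm_of_nonneg (norm_nonneg _), Real.norm_of_nonneg (by positivity), hxr] at hk1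
    -- `|k_x(v, w)| ≤ κ ‖v‖ ‖w‖` with `κ = (ε/16)/r²`
    have hκ : 0 ≤ ε / 16 / r ^ 2 := by positivity
    have hk : ∀ v w : E3, |kCoeff e D x v w| ≤ ε / 16 / r ^ 2 * ‖v‖ * ‖w‖ := by
      intro v w
      rw [← Real.norm_eq_abs]
      calc ‖kCoeff e D x v w‖ ≤ ‖kCoeff e D x‖ * ‖v‖ * ‖w‖ := (kCoeff e D x).le_opNorm₂ v w
        _ ≤ ε / 16 / r ^ 2 * ‖v‖ * ‖w‖ := by
          have : ‖kCoeff e D x‖ ≤ ε / 16 / r ^ 2 := by rw [div_eq_mul_inv]; exact hk1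
          gcongr
    -- coercivity of `h_x` and the bound on `‖h_x‖`
    have hH : ∀ v : E3, 1 / 2 * ‖v‖ ^ 2 ≤ hCoeff e D x v v := by
      intro v
      have h1 : hCoeff e D x v v = ‖v‖ ^ 2 + (hCoeff e D x - B) v v := by
        rw [sub_apply, sub_apply, hB, innerSL_apply_apply, real_inner_self_eq_norm_sq]
        ring
      have h2 : |(hCoeff e D x - B) v v| ≤ 1 / 2 * ‖v‖ * ‖v‖ := by
        rw [← Real.norm_eq_abs]
        calc _ ≤ ‖hCoeff e D x - B‖ * ‖v‖ * ‖v‖ := (hCoeff e D x - B).le_opNorm₂ v v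
          _ ≤ 1 / 2 * ‖v‖ * ‖v‖ := by gcongr
      rw [h1]
      have h3 := neg_abs_le ((hCoeff e D x - B) v v)
      have h4 : ‖v‖ ^ 2 = ‖v‖ * ‖v‖ := sq ‖v‖
      linarith
    have hhn : ‖hCoeff e D x‖ ≤ 3 / 2 := by
      calc ‖hCoeff e D x‖ = ‖B + (hCoeff e D x - B)‖ := by rw [add_sub_cancel]
        _ ≤ ‖B‖ + ‖hCoeff e D x - B‖ := norm_add_le _ _
        _ ≤ 1 + 1 / 2 := add_le_add (by rw [hB]; exact norm_innerSL_le ℝ) hh1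
        _ = 3 / 2 := by norm_num
    have htr := e.abs_trKCoeff_le D hxR hκ hH hk
    rw [Real.norm_eq_abs]
    exact e.abs_admMomentumIntegrand_le D i hr0 hxr hκ hk htr hhn
  have herr : ‖∫ x in S, I x ∂μ‖ ≤ 30 * (ε / 16 / r ^ 2) * (4 * Real.pi * r ^ 2) := by
    rw [← hμSr]
    exact norm_setIntegral_le_of_norm_le_const hμS' hbd
  -- conclusion
  rw [Real.dist_eq, sub_zero]
  change |(8 * Real.pi)⁻¹ * ∫ x in S, I x ∂μ| < ε
  rw [abs_mul, abs_of_pos (by positivity)]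
  rw [Real.norm_eq_abs] at herr
  calc (8 * Real.pi)⁻¹ * |∫ x in S, I x ∂μ|
      ≤ (8 * Real.pi)⁻¹ * (30 * (ε / 16 / r ^ 2) * (4 * Real.pi * r ^ 2)) :=
        mul_le_mul_of_nonneg_left herr (by positivity)
    _ = 15 * ε / 16 := by
        field_simp
        ring
    _ < ε := by linarith

/-- **The ADM linear momentum of a DR-strongly asymptotically flat end is `0`** (`limUnder` form).
Dafermos–Rodnianski 2013, App. B.2.3. [cite: DafermosRodnianski2013, App. B.2.3] -/
theorem IsStronglyAsymptoticallyFlatDR.admMomentum_eq_zero {e : AFEnd X}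
    {D : InitialDataSet (𝓡 3) X} {M : ℝ} (h : IsStronglyAsymptoticallyFlatDR e D M) (i : Fin 3) :
    admMomentum e D i = 0 :=
  (h.hasADMMomentum_zero i).admMomentum_eq

/-- **The ADM mass of a DR-strongly asymptotically flat end is `|M|`**: `√(E² − |P|²) = √(M²)`
(`E = M`, `IsStronglyAsymptoticallyFlatDR.admEnergy_eq`; `P = 0`). Dafermos–Rodnianski 2013,
App. B.2.3. [cite: DafermosRodnianski2013, App. B.2.3] -/
theorem IsStronglyAsymptoticallyFlatDR.admMass_eq {e : AFEnd X}
    {D : InitialDataSet (𝓡 3) X} {M : ℝ} (h : IsStronglyAsymptoticallyFlatDR e D M) :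
    admMass e D = |M| := by
  rw [admMass, h.admEnergy_eq]
  simp [h.admMomentum_eq_zero, Real.sqrt_sq_eq_abs]

/-- **The CK case**: the ADM linear momentum of a Christodoulou–Klainerman strongly asymptotically
flat end vanishes (the CK rates imply the DR ones). Christodoulou–Klainerman 1993, (1.0.9).
[cite: ChristodoulouKlainerman1993, (1.0.9)] -/
theorem IsStronglyAsymptoticallyFlatCK.hasADMMomentum_zero {e : AFEnd X}
    {D : InitialDataSet (𝓡 3) X} {M : ℝ} (h : IsStronglyAsymptoticallyFlatCK e D M) (i : Fin 3) :
    HasADMMomentum e D i 0 :=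
  h.isStronglyAsymptoticallyFlatDR.hasADMMomentum_zero i

end AFEnd

end Literature.Geometry.Lorentzian

end
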